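import Literature.MathematicalPhysics.QuantumLattice.GrassmannDeterminantBounded
import HarnessLib

/-!
# Algebra of charged Gram forms: differences, convex combinations and decoupled block copies stay Gram-bounded

Topic `MathematicalPhysics/QuantumLattice`; continuation of `GrassmannDeterminantBounded` (`isDetBoundedR_of_gram` /
`isGramBoundedR_of_gram`: a charged Gram form `contr C X̄ Y = ⟨f X̄, g Y⟩`, `‖f‖, ‖g‖ ≤ κ`, gives the replica-stable determinant / Gram
bound with constant `κ`, Benfatto–Giuliani–Mastropietro 2006 (2.80), de Siqueira Pedra–Salmhofer 2008 Thm 1.3).  The determinant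
bound is not additive in the covariance, but Gram FORMS are: in the orthogonal direct sum of the two representation spaces,
* `contr_gram_sub` / **`isGramBoundedR_sub_of_gram`** — `C₁ − C₂` has the Gram form `((f₁, f₂), (g₁, −g₂))`, constant `√(κ₁² + κ₂²)`
  (BGM 2006 (2.67)–(2.80): the interpolated covariances of the tree expansion are handled by exactly this device; here for the DEFECT
  covariance between a torus and the decoupled copies of a smaller one);
* **`isGramBoundedR_convex_of_gram`** — `(1 − s)C₁ + sC₂`, `s ∈ [0,1]`, has the form `((√(1−s)f₁, √s f₂), (√(1−s)g₁, √s g₂))`, constant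
  `max κ₁ κ₂` (BGM 2006 (2.67): `σ_s ∘ C`);
* **`isGramBoundedR_blockCopies_of_gram`** — DECOUPLED BLOCK COPIES: for a block map `blk : Γ′ → ι` and a projection `π : Γ′ → Γ`, the
  covariance `X′ Y′ ↦ [blk X′ = blk Y′]·C (π X′) (π Y′)` (independent copies of `C`, one per block) has the Gram form
  `X′ ↦ e_{blk X′} ⊗ f(π X′)` in `ℓ²(ι; E)`, same constant `κ`.

Everything is proved; no definition, no named fact.

## Sources
G. Benfatto, A. Giuliani, V. Mastropietro, Ann. Henri Poincaré 7 (2006) 809–898, (2.67), (2.80) [`BenfattoGiulianiMastropietro2006`];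
W. de Siqueira Pedra, M. Salmhofer, Comm. Math. Phys. 282 (2008) 797–818, Thm 1.3 [`PedraSalmhofer2008`].
-/

noncomputable section

namespace Literature.MathematicalPhysics.QuantumLattice

open GrassmannAlgebra Finset
open scoped InnerProductSpace

universe u

variable {𝕜 : Type*} [RCLike 𝕜]
variable {E₁ : Type*} [NormedAddCommGroup E₁] [InnerProductSpace 𝕜 E₁]
variable {E₂ : Type*} [NormedAddCommGroup E₂] [InnerProductSpace 𝕜 E₂]
variable {Γ : Type u} [Fintype Γ] [DecidableEq Γ]

/-! ### The two-point function is linear in the covariance -/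

omit [Fintype Γ] [DecidableEq Γ] in
/-- `contr` is additive in the covariance. [cite: BenfattoGiulianiMastropietro2006, (2.67)] -/
theorem contr_add_apply' (A B : Matrix Γ Γ 𝕜) (X Y : Γ) : contr 𝕜 (A + B) X Y = contr 𝕜 A X Y + contr 𝕜 B X Y := by
  simp only [contr_apply, Matrix.add_apply]; ring

omit [Fintype Γ] [DecidableEq Γ] in
/-- `contr` is subtractive in the covariance. [cite: BenfattoGiulianiMastropietro2006, (2.67)] -/
theorem contr_sub_apply' (A B : Matrix Γ Γ 𝕜) (X Y : Γ) : contr 𝕜 (A - B) X Y = contr 𝕜 A X Y - contr 𝕜 B X Y := by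
  simp only [contr_apply, Matrix.sub_apply]; ring

omit [Fintype Γ] [DecidableEq Γ] in
/-- `contr` is homogeneous in the covariance. [cite: BenfattoGiulianiMastropietro2006, (2.67)] -/
theorem contr_smul_apply' (c : 𝕜) (A : Matrix Γ Γ 𝕜) (X Y : Γ) : contr 𝕜 (c • A) X Y = c * contr 𝕜 A X Y := by
  simp only [contr_apply, Matrix.smul_apply, smul_eq_mul]; ring

/-! ### Differences of Gram forms -/

omit [Fintype Γ] [DecidableEq Γ] in
/-- **The difference of two charged Gram forms is a charged Gram form** in the direct sum `E₁ ⊕ E₂` (second factor of `g` negated).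
[cite: BenfattoGiulianiMastropietro2006, (2.67)-(2.80)] -/
theorem contr_gram_sub (q : Γ → Bool) (C₁ C₂ : Matrix Γ Γ 𝕜) (f₁ g₁ : Γ → E₁) (f₂ g₂ : Γ → E₂)
    (hG₁ : ∀ X Y, q X = true → q Y = false → contr 𝕜 C₁ X Y = ⟪f₁ X, g₁ Y⟫_𝕜)
    (hG₂ : ∀ X Y, q X = true → q Y = false → contr 𝕜 C₂ X Y = ⟪f₂ X, g₂ Y⟫_𝕜) (X Y : Γ) (hX : q X = true) (hY : q Y = false) :
    contr 𝕜 (C₁ - C₂) X Y = ⟪(WithLp.toLp 2 (f₁ X, f₂ X) : WithLp 2 (E₁ × E₂)), WithLp.toLp 2 (g₁ Y, -g₂ Y)⟫_𝕜 := by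
  rw [contr_sub_apply', hG₁ X Y hX hY, hG₂ X Y hX hY, WithLp.prod_inner_apply]
  simp [inner_neg_right, sub_eq_add_neg]

omit [Fintype Γ] [DecidableEq Γ] in
/-- Norm of a pair in `WithLp 2 (E₁ × E₂)` from norms of the components. [cite: BenfattoGiulianiMastropietro2006, (2.80)] -/
theorem norm_toLp_prod_le {x : E₁} {y : E₂} {a b : ℝ} (ha : ‖x‖ ≤ a) (hb : ‖y‖ ≤ b) :
    ‖(WithLp.toLp 2 (x, y) : WithLp 2 (E₁ × E₂))‖ ≤ Real.sqrt (a ^ 2 + b ^ 2) := by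
  have h0a : 0 ≤ a := (norm_nonneg _).trans ha
  have h0b : 0 ≤ b := (norm_nonneg _).trans hb
  rw [WithLp.prod_norm_eq_of_L2]
  refine Real.sqrt_le_sqrt (add_le_add ?_ ?_)
  · simpa using pow_le_pow_left₀ (norm_nonneg _) ha 2
  · simpa using pow_le_pow_left₀ (norm_nonneg _) hb 2

omit [DecidableEq Γ] in
/-- **`C₁ − C₂` IS REPLICA-GRAM-BOUNDED WITH CONSTANT `√(κ₁² + κ₂²)`** when both have charged Gram forms (same charge `q`) with constants
`κ₁, κ₂` and both vanish on equal charges. [cite: BenfattoGiulianiMastropietro2006, (2.80)] -/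
theorem isGramBoundedR_sub_of_gram (q : Γ → Bool) (C₁ C₂ : Matrix Γ Γ 𝕜)
    (hC₁ : ∀ X Y, q X = q Y → C₁ X Y = 0) (hC₂ : ∀ X Y, q X = q Y → C₂ X Y = 0)
    (f₁ g₁ : Γ → E₁) (f₂ g₂ : Γ → E₂) {κ₁ κ₂ : ℝ}
    (hf₁ : ∀ X, q X = true → ‖f₁ X‖ ≤ κ₁) (hg₁ : ∀ Y, q Y = false → ‖g₁ Y‖ ≤ κ₁)
    (hf₂ : ∀ X, q X = true → ‖f₂ X‖ ≤ κ₂) (hg₂ : ∀ Y, q Y = false → ‖g₂ Y‖ ≤ κ₂)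
    (hG₁ : ∀ X Y, q X = true → q Y = false → contr 𝕜 C₁ X Y = ⟪f₁ X, g₁ Y⟫_𝕜)
    (hG₂ : ∀ X Y, q X = true → q Y = false → contr 𝕜 C₂ X Y = ⟪f₂ X, g₂ Y⟫_𝕜) :
    IsGramBoundedR (C₁ - C₂) (Real.sqrt (κ₁ ^ 2 + κ₂ ^ 2)) := by
  refine isGramBoundedR_of_gram q (C₁ - C₂) (fun X Y h => by rw [Matrix.sub_apply, hC₁ X Y h, hC₂ X Y h, sub_zero])
    (fun X => (WithLp.toLp 2 (f₁ X, f₂ X) : WithLp 2 (E₁ × E₂))) (fun Y => WithLp.toLp 2 (g₁ Y, -g₂ Y)) (Real.sqrt_nonneg _)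
    (fun X hX => norm_toLp_prod_le (hf₁ X hX) (hf₂ X hX)) (fun Y hY => norm_toLp_prod_le (hg₁ Y hY) ?_)
    (fun X Y hX hY => contr_gram_sub q C₁ C₂ f₁ g₁ f₂ g₂ hG₁ hG₂ X Y hX hY)
  rw [norm_neg]; exact hg₂ Y hY

/-! ### Convex combinations of Gram forms -/

omit [Fintype Γ] [DecidableEq Γ] in
/-- **The convex combination `(1 − s)C₁ + sC₂` of two charged Gram forms is a charged Gram form** with the weights `√(1−s)`, `√s` on both
factors (`s ∈ [0,1]`). [cite: BenfattoGiulianiMastropietro2006, (2.67)] -/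
theorem contr_gram_convex (q : Γ → Bool) (C₁ C₂ : Matrix Γ Γ 𝕜) (f₁ g₁ : Γ → E₁) (f₂ g₂ : Γ → E₂)
    (hG₁ : ∀ X Y, q X = true → q Y = false → contr 𝕜 C₁ X Y = ⟪f₁ X, g₁ Y⟫_𝕜)
    (hG₂ : ∀ X Y, q X = true → q Y = false → contr 𝕜 C₂ X Y = ⟪f₂ X, g₂ Y⟫_𝕜) {s : ℝ} (hs0 : 0 ≤ s) (hs1 : s ≤ 1)
    (X Y : Γ) (hX : q X = true) (hY : q Y = false) :
    contr 𝕜 (((1 - s : ℝ) : 𝕜) • C₁ + ((s : ℝ) : 𝕜) • C₂) X Y =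
      ⟪(WithLp.toLp 2 ((Real.sqrt (1 - s) : 𝕜) • f₁ X, (Real.sqrt s : 𝕜) • f₂ X) : WithLp 2 (E₁ × E₂)),
        WithLp.toLp 2 ((Real.sqrt (1 - s) : 𝕜) • g₁ Y, (Real.sqrt s : 𝕜) • g₂ Y)⟫_𝕜 := by
  have h1 : ∀ z : 𝕜, ((Real.sqrt (1 - s) : ℝ) : 𝕜) * (((Real.sqrt (1 - s) : ℝ) : 𝕜) * z) = ((1 - s : ℝ) : 𝕜) * z := by
    intro z
    rw [← mul_assoc, ← RCLike.ofReal_mul, Real.mul_self_sqrt (by linarith)]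
  have h2 : ∀ z : 𝕜, ((Real.sqrt s : ℝ) : 𝕜) * (((Real.sqrt s : ℝ) : 𝕜) * z) = ((s : ℝ) : 𝕜) * z := by
    intro z
    rw [← mul_assoc, ← RCLike.ofReal_mul, Real.mul_self_sqrt hs0]
  rw [contr_add_apply', contr_smul_apply', contr_smul_apply', hG₁ X Y hX hY, hG₂ X Y hX hY, WithLp.prod_inner_apply]
  simp [inner_smul_left, inner_smul_right, h1, h2]

omit [Fintype Γ] [DecidableEq Γ] in
/-- Norm of the weighted pair: `‖(√(1−s)x, √s y)‖ ≤ max a b` for `‖x‖ ≤ a`, `‖y‖ ≤ b`, `s ∈ [0,1]`. [cite: BenfattoGiulianiMastropietro2006, (2.80)] -/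
theorem norm_toLp_convex_le {x : E₁} {y : E₂} {a b s : ℝ} (ha : ‖x‖ ≤ a) (hb : ‖y‖ ≤ b) (hs0 : 0 ≤ s) (hs1 : s ≤ 1) :
    ‖(WithLp.toLp 2 ((Real.sqrt (1 - s) : 𝕜) • x, (Real.sqrt s : 𝕜) • y) : WithLp 2 (E₁ × E₂))‖ ≤ max a b := by
  have h0a : 0 ≤ a := (norm_nonneg _).trans ha
  have h0b : 0 ≤ b := (norm_nonneg _).trans hb
  set m := max a b with hm
  have hm0 : 0 ≤ m := h0a.trans (le_max_left _ _)
  have hxm : ‖x‖ ≤ m := ha.trans (le_max_left _ _)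
  have hym : ‖y‖ ≤ m := hb.trans (le_max_right _ _)
  have e1 : ‖(WithLp.toLp 2 ((Real.sqrt (1 - s) : 𝕜) • x, (Real.sqrt s : 𝕜) • y) : WithLp 2 (E₁ × E₂)).fst‖ = Real.sqrt (1 - s) * ‖x‖ := by
    simp [norm_smul, abs_of_nonneg (Real.sqrt_nonneg _)]
  have e2 : ‖(WithLp.toLp 2 ((Real.sqrt (1 - s) : 𝕜) • x, (Real.sqrt s : 𝕜) • y) : WithLp 2 (E₁ × E₂)).snd‖ = Real.sqrt s * ‖y‖ := by
    simp [norm_smul, abs_of_nonneg (Real.sqrt_nonneg _)]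
  rw [WithLp.prod_norm_eq_of_L2, e1, e2]
  calc Real.sqrt ((Real.sqrt (1 - s) * ‖x‖) ^ 2 + (Real.sqrt s * ‖y‖) ^ 2)
      = Real.sqrt ((1 - s) * ‖x‖ ^ 2 + s * ‖y‖ ^ 2) := by
        rw [mul_pow, mul_pow, Real.sq_sqrt (by linarith), Real.sq_sqrt hs0]
    _ ≤ Real.sqrt ((1 - s) * m ^ 2 + s * m ^ 2) := by
        gcongr
    _ = m := by rw [show (1 - s) * m ^ 2 + s * m ^ 2 = m ^ 2 by ring, Real.sqrt_sq hm0]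

omit [DecidableEq Γ] in
/-- **`(1 − s)C₁ + sC₂` IS REPLICA-GRAM-BOUNDED WITH CONSTANT `max κ₁ κ₂`** for `s ∈ [0,1]` (charged Gram forms, vanishing on equal charges).
[cite: BenfattoGiulianiMastropietro2006, (2.80)] -/
theorem isGramBoundedR_convex_of_gram (q : Γ → Bool) (C₁ C₂ : Matrix Γ Γ 𝕜)
    (hC₁ : ∀ X Y, q X = q Y → C₁ X Y = 0) (hC₂ : ∀ X Y, q X = q Y → C₂ X Y = 0)
    (f₁ g₁ : Γ → E₁) (f₂ g₂ : Γ → E₂) {κ₁ κ₂ : ℝ} (hκ₁ : 0 ≤ κ₁)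
    (hf₁ : ∀ X, q X = true → ‖f₁ X‖ ≤ κ₁) (hg₁ : ∀ Y, q Y = false → ‖g₁ Y‖ ≤ κ₁)
    (hf₂ : ∀ X, q X = true → ‖f₂ X‖ ≤ κ₂) (hg₂ : ∀ Y, q Y = false → ‖g₂ Y‖ ≤ κ₂)
    (hG₁ : ∀ X Y, q X = true → q Y = false → contr 𝕜 C₁ X Y = ⟪f₁ X, g₁ Y⟫_𝕜)
    (hG₂ : ∀ X Y, q X = true → q Y = false → contr 𝕜 C₂ X Y = ⟪f₂ X, g₂ Y⟫_𝕜) {s : ℝ} (hs0 : 0 ≤ s) (hs1 : s ≤ 1) :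
    IsGramBoundedR (((1 - s : ℝ) : 𝕜) • C₁ + ((s : ℝ) : 𝕜) • C₂) (max κ₁ κ₂) := by
  refine isGramBoundedR_of_gram q _
    (fun X Y h => by rw [Matrix.add_apply, Matrix.smul_apply, Matrix.smul_apply, hC₁ X Y h, hC₂ X Y h, smul_zero, smul_zero, add_zero])
    (fun X => (WithLp.toLp 2 ((Real.sqrt (1 - s) : 𝕜) • f₁ X, (Real.sqrt s : 𝕜) • f₂ X) : WithLp 2 (E₁ × E₂)))
    (fun Y => WithLp.toLp 2 ((Real.sqrt (1 - s) : 𝕜) • g₁ Y, (Real.sqrt s : 𝕜) • g₂ Y)) (hκ₁.trans (le_max_left _ _))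
    (fun X hX => norm_toLp_convex_le (hf₁ X hX) (hf₂ X hX) hs0 hs1) (fun Y hY => norm_toLp_convex_le (hg₁ Y hY) (hg₂ Y hY) hs0 hs1)
    (fun X Y hX hY => contr_gram_convex q C₁ C₂ f₁ g₁ f₂ g₂ hG₁ hG₂ hs0 hs1 X Y hX hY)

/-! ### Decoupled block copies -/

omit [Fintype Γ] [DecidableEq Γ] in
/-- **DECOUPLED BLOCK COPIES OF A GRAM FORM ARE A GRAM FORM** in `ℓ²(ι; E)`: for a block map `blk : Γ′ → ι`, a projection `π : Γ′ → Γ`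
and a covariance `C′` on `Γ′` with `contr C′ X′ Y′ = [blk X′ = blk Y′]·contr C (π X′) (π Y′)` (independent copies of `C`, one per block),
a charged Gram form of `C` (charge `q ∘ π`-compatible) gives one of `C′` with the same constant; hence `C′` is replica-Gram-bounded with
constant `κ`. [cite: BenfattoGiulianiMastropietro2006, (2.80)] -/
theorem isGramBoundedR_blockCopies_of_gram {Γ' : Type u} [Fintype Γ'] [DecidableEq Γ'] {ι : Type*} [Fintype ι] [DecidableEq ι]
    (blk : Γ' → ι) (π : Γ' → Γ) (q : Γ → Bool) (C : Matrix Γ Γ 𝕜) (C' : Matrix Γ' Γ' 𝕜)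
    (hC' : ∀ X' Y', q (π X') = q (π Y') → C' X' Y' = 0)
    (hcontr : ∀ X' Y', q (π X') = true → q (π Y') = false →
      contr 𝕜 C' X' Y' = if blk X' = blk Y' then contr 𝕜 C (π X') (π Y') else 0)
    (f g : Γ → E₁) {κ : ℝ} (hκ : 0 ≤ κ) (hf : ∀ X, q X = true → ‖f X‖ ≤ κ) (hg : ∀ Y, q Y = false → ‖g Y‖ ≤ κ)
    (hG : ∀ X Y, q X = true → q Y = false → contr 𝕜 C X Y = ⟪f X, g Y⟫_𝕜) :
    IsGramBoundedR C' κ := by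
  classical
  -- the block-supported vectors `e_{blk X′} ⊗ f(π X′)` in `ℓ²(ι; E₁)`
  let F : Γ' → PiLp 2 (fun _ : ι => E₁) := fun X' => WithLp.toLp 2 (Pi.single (blk X') (f (π X')))
  let G : Γ' → PiLp 2 (fun _ : ι => E₁) := fun Y' => WithLp.toLp 2 (Pi.single (blk Y') (g (π Y')))
  have hFn : ∀ X', ‖F X'‖ = ‖f (π X')‖ := by
    intro X'
    rw [PiLp.norm_eq_of_L2, Finset.sum_eq_single (blk X')]
    · simp [F]
    · intro i _ hi; simp [F, Pi.single_eq_of_ne hi]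
    · intro h; exact absurd (Finset.mem_univ _) h
  have hGn : ∀ Y', ‖G Y'‖ = ‖g (π Y')‖ := by
    intro Y'
    rw [PiLp.norm_eq_of_L2, Finset.sum_eq_single (blk Y')]
    · simp [G]
    · intro i _ hi; simp [G, Pi.single_eq_of_ne hi]
    · intro h; exact absurd (Finset.mem_univ _) h
  have hFG : ∀ X' Y', ⟪F X', G Y'⟫_𝕜 = if blk X' = blk Y' then ⟪f (π X'), g (π Y')⟫_𝕜 else 0 := by
    intro X' Y'
    rw [PiLp.inner_apply, Finset.sum_eq_single (blk X')]
    · by_cases h : blk X' = blk Y'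
      · simp [F, G, h]
      · simp [F, G, h]
    · intro i _ hi; simp [F, Pi.single_eq_of_ne hi]
    · intro h; exact absurd (Finset.mem_univ _) h
  refine isGramBoundedR_of_gram (fun X' => q (π X')) C' hC' F G hκ (fun X' hX => by rw [hFn]; exact hf _ hX)
    (fun Y' hY => by rw [hGn]; exact hg _ hY) (fun X' Y' hX hY => ?_)
  rw [hcontr X' Y' hX hY, hFG]
  split_ifs with h
  · exact hG _ _ hX hY
  · rfl

/-! ### Scaling a Gram form by `s ∈ [0,1]` (the straight path `s ↦ s • D` of a Duhamel step) -/

omit [DecidableEq Γ] in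
/-- **`s • C` IS REPLICA-GRAM-BOUNDED WITH THE SAME CONSTANT** for `s ∈ [0,1]` (real scalar acting through the algebra map): the Gram form is
rescaled by `√s` on both factors.  The covariances `s • D`, `s ∈ [0,1]`, of the straight Duhamel path of a far-supported defect step are thus
uniformly Gram-bounded. [cite: BenfattoGiulianiMastropietro2006, (2.67)-(2.80)] -/
theorem isGramBoundedR_smul_of_gram (q : Γ → Bool) (C : Matrix Γ Γ 𝕜) (hC : ∀ X Y, q X = q Y → C X Y = 0)
    (f g : Γ → E₁) {κ : ℝ} (hκ : 0 ≤ κ) (hf : ∀ X, q X = true → ‖f X‖ ≤ κ) (hg : ∀ Y, q Y = false → ‖g Y‖ ≤ κ)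
    (hG : ∀ X Y, q X = true → q Y = false → contr 𝕜 C X Y = ⟪f X, g Y⟫_𝕜) {s : ℝ} (hs0 : 0 ≤ s) (hs1 : s ≤ 1) :
    IsGramBoundedR (s • C) κ := by
  have hsq : Real.sqrt s ≤ 1 := Real.sqrt_le_one.mpr hs1
  refine isGramBoundedR_of_gram q (s • C) (fun X Y h => by rw [Matrix.smul_apply, hC X Y h, smul_zero])
    (fun X => ((Real.sqrt s : ℝ) : 𝕜) • f X) (fun Y => ((Real.sqrt s : ℝ) : 𝕜) • g Y) hκ
    (fun X hX => ?_) (fun Y hY => ?_) (fun X Y hX hY => ?_)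
  · rw [norm_smul, RCLike.norm_ofReal, abs_of_nonneg (Real.sqrt_nonneg _)]
    exact (mul_le_mul hsq (hf X hX) (norm_nonneg _) zero_le_one).trans_eq (one_mul κ)
  · rw [norm_smul, RCLike.norm_ofReal, abs_of_nonneg (Real.sqrt_nonneg _)]
    exact (mul_le_mul hsq (hg Y hY) (norm_nonneg _) zero_le_one).trans_eq (one_mul κ)
  · rw [inner_smul_left, inner_smul_right, RCLike.conj_ofReal, ← mul_assoc, ← RCLike.ofReal_mul, Real.mul_self_sqrt hs0, ← hG X Y hX hY]
    have h : (s • C) = ((s : ℝ) : 𝕜) • C := by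
      ext X' Y'; simp [Matrix.smul_apply, RCLike.real_smul_eq_coe_mul]
    rw [h, contr_smul_apply']

end Literature.MathematicalPhysics.QuantumLattice

end
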